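/-
Copyright (c) 2026 the pub-hodgecm-mathlib formalisation cell (harness21).  Prover seat hodgecm-mathlib-F0P3a-p06-g25 (PLACE-FREE LAYER after RIDER 2b; `hd ↦ hϖ` substitution
certified by «LH5» LH5-p04 (g10); LEAD F0P3a-plan (g16) T15-25 (b)(c), T15-30 (i); G-row LEDGER v13 OPEN item); 2026-09-03.
-/
import Summits.HodgeConjecture.HodgeConjecture.Theorems.F0P3cStCharTSEPTracesPF            -- P3 (this seat): the place-free trace table; brings P1, P2a, P2b, ★ A–H inputs
import Summits.HodgeConjecture.HodgeConjecture.Theorems.F0P3cStCharTSP1261bOfCases          -- ★ p852991 (this seat): `isEllipticPairEP_of_table`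
import Summits.HodgeConjecture.HodgeConjecture.Theorems.F0P3cStCharTSPctOut                  -- ★ PCT-OUT `pseudoCoeffTrace_Gqs`
import Summits.HodgeConjecture.HodgeConjecture.Theorems.F0P3cStCharTSEPPseudoCoeffStUnr      -- ★ (G5) C (F0P3-p02): `charOpposite_stG_detG_of_PS2`
import Summits.HodgeConjecture.HodgeConjecture.Theorems.F0P3cStCharTSEPGlueGExplicitNotWild  -- ★ NOT-WILD p853198 (LH5-p04): `exists_uniformizer_epFunction_G_explicit_of_not_wild`
import HarnessLib

/-!
# F0 · P3c · line LH6 «StCharTS» — PLACE-FREE LAYER P4 «EP-PAIRS NOT-WILD»: the EP-family instance of Prop. 12.6.1 (b) at EVERY non-split, NOT wildly ramified `v`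
# HEAD `isEllipticPair_of_epFamily_of_not_wild (hv : Algebra.IsUnramifiedIn (𝓞 L) 𝔭_v ∨ |2|_v = 1)` — ★ H's head with `hunr` widened to RIDER 2a′'s place token

Cell `pub/hodgecm-mathlib` (D-0151), FLOOR 0, crux item H413 = `stmt-HodgeConjecture-24833` (`--supports` lane, helper; seat F0P3a-p06 (g25)).  THEOREMS ONLY.  §2–§3 = ★ G
§2–§3 with `hd ↦ hϖ` (table rows `⟨χ_{St ψ}, χ_{St ψ′}⟩_e = [ψ = ψ′]`, `⟨χ_{St ψ}, χ_{det ψ′}⟩_e = −[ψ = ψ′]`, `⟨χ_{det ψ}, χ_{det ψ′}⟩_e = [ψ = ψ′]` by ★ PCT at the EP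
pseudo-coefficients of ★ (G5) A; `isEllipticPairEP_datum` = ★ `isEllipticPairEP_of_table` on them); §4 = the junction-facing heads over ★ NOT-WILD p853198 (one `obtain`), binders
= ★ H's with `hunr ↦ hv`.  CONSUMER (later, LEAD's word): a ONE-TOKEN rider widening RIDER 2b's guard conjunct `Algebra.IsUnramifiedIn (𝓞 L) v.asIdeal` to the disjunction,
`exact …EPPairsNotWild.isEllipticPair_of_epFamily_of_not_wild … hep.1 …`.
HONEST LABEL: count-neutral helper layer (the guard widening of 2b from `Algebra.IsUnramifiedIn` to «not wild» is a later ONE-TOKEN rider on the LEAD's word); ★ files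
untouched; closes no node; HC_CM is proved only modulo the 7 printed citations (hLiu418 = stmt-HodgeConjecture-24832, h413 = stmt-HodgeConjecture-24833) until rung 0 closes.

## References
* [Rogawski1990] J. D. Rogawski, *Automorphic Representations of Unitary Groups in Three Variables*, Ann. of Math. Stud. 123 (1990), §12.6 Prop. 12.6.1 (b)(c) p. 188; §12.5 p. 184.
* [Kottwitz1988] R. E. Kottwitz, *Tamagawa numbers*, Ann. of Math. 127 (1988), §2 Theorem 2.
* [Tits1979] J. Tits, *Reductive groups over local fields*, PSPM 33.1 (1979), §2.4.
-/

set_option autoImplicit false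
-- the mandated namespace has the single-problem summit's repeated segment (`HodgeConjecture.HodgeConjecture`)
set_option linter.dupNamespace false

noncomputable section

open NumberField IsDedekindDomain MeasureTheory Topology
open scoped Matrix MatrixGroups NNReal WithZero ComplexConjugate
open Literature.NumberTheory.Automorphic Literature.NumberTheory.Automorphic.UnitaryGroup
open Literature.NumberTheory.Rogawski1990 Literature.NumberTheory.Rogawski1990.Ch12Sec5 Literature.NumberTheory.GaloisRepresentations
open Summit.HodgeConjecture.HodgeConjecture.Cruxes.H413.F0P3cStCharTSTorusDefs
open scoped Valued

namespace Summit.HodgeConjecture.HodgeConjecture.Cruxes.H413.F0P3cStCharTSEPPairsNotWild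

open Summit.HodgeConjecture.HodgeConjecture.Cruxes.H413
open Summit.HodgeConjecture.HodgeConjecture.Cruxes.H413.F0P3cStCharTSEPPseudoCoeffSt
open Summit.HodgeConjecture.HodgeConjecture.Cruxes.H413.F0P3cStCharTSP1261bOfCases
open Summit.HodgeConjecture.HodgeConjecture.Cruxes.H413.F0P3cStCharTSEPPseudoCoeffStUnr (charOpposite_stG_detG_of_PS2)

variable (L : Type) [Field L] [NumberField L] [IsCMField L] (v : HeightOneSpectrum (𝓞 ↥(maximalRealSubfield L)))

section Table

variable
  (w : PlacesOver L v) (hw : IsCMField.complexConj L • w.1 = w.1)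
  (eA : Gqs L v ≃ₜ* ↥(unitaryGroupOfForm (galAdicCompletionMap (L := L) (IsCMField.complexConj L) hw) ((StdForm.antidiagonal 3).over (w.1.adicCompletion L))))
  (heA : ∀ g : Gqs L v,
    ((eA g : ↥(unitaryGroupOfForm (galAdicCompletionMap (L := L) (IsCMField.complexConj L) hw) ((StdForm.antidiagonal 3).over (w.1.adicCompletion L)))) : GL (Fin 3) (w.1.adicCompletion L)) =
      ((localNonsplitEquiv (IsCMField.complexConj L) (qsForm L) (IsCMField.complexConj_ne_one L) w hw g :
        ↥(unitaryGroupOfForm (galAdicCompletionMap (L := L) (IsCMField.complexConj L) hw) (placeForm (qsForm L) w.1))) : GL (Fin 3) (w.1.adicCompletion L)))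
  (hns : ∀ w' : PlacesOver L v, IsCMField.complexConj L • w'.1 = w'.1) {ϖ : w.1.adicCompletion L}
  (g₁ : GL (Fin 3) (w.1.adicCompletion L)) (hg₁ : (g₁ : Matrix (Fin 3) (Fin 3) (w.1.adicCompletion L)) = Matrix.diagonal ![(1 : w.1.adicCompletion L), 1, ϖ])
  (K0 K1 I : Subgroup (Gqs L v))
  (hK0 : K0 = ((glInt 3 (w.1.adicCompletion L)).subgroupOf
    (unitaryGroupOfForm (galAdicCompletionMap (L := L) (IsCMField.complexConj L) hw) ((StdForm.antidiagonal 3).over (w.1.adicCompletion L)))).comap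
      eA.toMulEquiv.toMonoidHom)
  (hK1 : K1 = (((glInt 3 (w.1.adicCompletion L)).map (MulAut.conj g₁).toMonoidHom).subgroupOf
    (unitaryGroupOfForm (galAdicCompletionMap (L := L) (IsCMField.complexConj L) hw) ((StdForm.antidiagonal 3).over (w.1.adicCompletion L)))).comap
      eA.toMulEquiv.toMonoidHom)
  (hI : I = K0 ⊓ K1)
  [MeasurableSpace (Gqs L v)] [BorelSpace (Gqs L v)] (νQv : Measure (Gqs L v)) [νQv.IsHaarMeasure]
  (fG : Gqs L v → ℂ)
  (hfG : fG = fun g => (((νQv K0).toReal : ℂ))⁻¹ * (K0 : Set (Gqs L v)).indicator (fun _ => (1 : ℂ)) g +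
    (((νQv K1).toReal : ℂ))⁻¹ * (K1 : Set (Gqs L v)).indicator (fun _ => (1 : ℂ)) g -
    (((νQv I).toReal : ℂ))⁻¹ * (I : Set (Gqs L v)).indicator (fun _ => (1 : ℂ)) g)
  (ι : ↥(normOneUnits (conjLocal L (IsCMField.complexConj L) v)) →* ↥(Subgroup.center (Gqs L v))) (hιc : Continuous ι)
  (hι : ∀ z : ↥(normOneUnits (conjLocal L (IsCMField.complexConj L) v)),
    ((ι z).val.val.val : Matrix (Fin 3) (Fin 3) (LocalRing L v)) = (((z : (LocalRing L v)ˣ) : LocalRing L v)) • (1 : Matrix (Fin 3) (Fin 3) (LocalRing L v)))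
  (detZ : Gqs L v →* ↥(Subgroup.center (Gqs L v)))
  (hdetZ : ∀ g : Gqs L v, ((detZ g).val.val.val : Matrix (Fin 3) (Fin 3) (LocalRing L v)) =
      (g.val.val : Matrix (Fin 3) (Fin 3) (LocalRing L v)).det • (1 : Matrix (Fin 3) (Fin 3) (LocalRing L v)))
  [MeasurableSpace (Gqs L v ⧸ Subgroup.center (Gqs L v))] (μZ : Measure (Gqs L v ⧸ Subgroup.center (Gqs L v)))

/-! ## §2 The trace table of `⟨·,·⟩_e` on the EP family at a §12.5 datum (★ PCT at the EP pseudo-coefficients of ★ (G5) A) -/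

section Datum

variable [∀ γ : Gqs L v, MeasurableSpace (Gqs L v ⧸ Subgroup.centralizer ({γ} : Set (Gqs L v)))]
  {H : Type} [Group H] [TopologicalSpace H] [IsTopologicalGroup H] [MeasurableSpace H]
  (mQv : OrbitalMeasureFamily (Gqs L v)) (𝔇 : EllipticData (Gqs L v) H)
  (hμG : 𝔇.μG = νQv) (horb : 𝔇.orb = mQv)
  (hreg : ∀ γ : Gqs L v, γ ∈ 𝔇.regG ↔ IsRegularElt (γ.val : GL (Fin 3) (UnitaryGroup.LocalRing L v)))
  (hE : ∀ γ : Gqs L v, γ ∈ 𝔇.ellG ↔ IsRegularElt (γ.val : GL (Fin 3) (UnitaryGroup.LocalRing L v)) ∧ γ ∉ hyperbolicSet L v)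
  (hM1 : ∀ π : IrrClass (Gqs L v), Measurable (𝔇.char π) ∧ LocallyIntegrable (𝔇.char π) 𝔇.μG ∧
    (∀ x ∈ 𝔇.regG, ∀ᶠ y in 𝓝 x, 𝔇.char π y = 𝔇.char π x) ∧
    ∀ φ : Gqs L v → ℂ, IsLocSmooth φ → π.smoothTrace 𝔇.μG φ = ∫ x, φ x * 𝔇.char π x ∂𝔇.μG)
  (hPCT : Ch12Sec6.PseudoCoeffTrace 𝔇)
  (hfGs : IsLocSmooth fG)
  (h1 : ∀ γ : Gqs L v, IsRegularElt (γ.val : GL (Fin 3) (UnitaryGroup.LocalRing L v)) →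
    IsCompact ((Subgroup.centralizer ({γ} : Set (Gqs L v))) : Set (Gqs L v)) → classOrbitalIntegral mQv fG (ConjClasses.mk γ) = 1)
  (h0 : ∀ γ : Gqs L v, IsRegularElt (γ.val : GL (Fin 3) (UnitaryGroup.LocalRing L v)) →
    ¬ IsCompact ((Subgroup.centralizer ({γ} : Set (Gqs L v))) : Set (Gqs L v)) → classOrbitalIntegral mQv fG (ConjClasses.mk γ) = 0)
  (hdet : ∀ ψ : ↥(Subgroup.center (Gqs L v)) →* ℂˣ, Continuous ψ →
    ∃ hopen : IsOpen (((ψ.comp detZ).ker : Subgroup (Gqs L v)) : Set (Gqs L v)), 𝔇.detG ψ = IrrClass.mk (SmoothIrrep.ofChar (ψ.comp detZ) hopen))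
  (hne : ∀ ψ : ↥(Subgroup.center (Gqs L v)) →* ℂˣ, Continuous ψ → 𝔇.stG ψ ≠ 𝔇.detG ψ)
  (hJH : ∀ ψ : ↥(Subgroup.center (Gqs L v)) →* ℂˣ, Continuous ψ → ∀ c : IrrClass (Gqs L v),
    c.IsConstituentOf (cmPrincipalSeries L 3 v
      (cmTorusCharPair L v (halfModulusChar (LocalRing L v) * halfModulusChar (LocalRing L v))⁻¹ (ψ.comp ι))) ↔ (c = 𝔇.stG ψ ∨ c = 𝔇.detG ψ))
  (hStL2 : ∀ ψ : ↥(Subgroup.center (Gqs L v)) →* ℂˣ, Continuous ψ → (𝔇.stG ψ).IsSquareIntegrable μZ)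
  (hDet : ∀ ψ : ↥(Subgroup.center (Gqs L v)) →* ℂˣ, Continuous ψ → ¬ (𝔇.detG ψ).IsSquareIntegrable μZ)
  (hOpp : ∀ ψ : ↥(Subgroup.center (Gqs L v)) →* ℂˣ, Continuous ψ → ∀ γ ∈ 𝔇.ellG, 𝔇.char (𝔇.stG ψ) γ = -𝔇.char (𝔇.detG ψ) γ)

include heA hns hg₁ hK0 hK1 hI hfG hιc hι hdetZ hμG horb hreg hE hM1 hPCT hfGs h1 h0 hdet hne hJH hStL2 hDet hOpp in
open Classical in
set_option maxHeartbeats 1600000 in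
set_option synthInstance.maxHeartbeats 400000 in
-- instance-path unification between `Gqs L v` and the literal carrier of ★ `cmPrincipalSeries`
/-- **TABLE ROW 1: `⟨χ_{St_G(ψ)}, χ_{St_G(ψ′)}⟩_e = [ψ = ψ′]`** (★ PCT at the pseudo-coefficient `f_{St ψ′}` of ★ (G5) A `isPseudoCoeff_stG_of_ep`; §1 `F0P3cStCharTSEPTracesPF.smoothTrace_stG_epSt`).
[cite: Rogawski1990, §12.6 Prop. 12.6.1 (b) p. 188; §12.5 p. 184] [cite: Kottwitz1988, §2 Theorem 2] -/
theorem innerG_char_stG_stG (hϖ : Valued.v ϖ = WithZero.exp (-1 : ℤ)) (ψ ψ' : ↥(Subgroup.center (Gqs L v)) →* ℂˣ) (hψ : Continuous ψ) (hψ' : Continuous ψ') :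
    𝔇.innerG (𝔇.char (𝔇.stG ψ)) (𝔇.char (𝔇.stG ψ')) = if ψ = ψ' then 1 else 0 := by
  obtain ⟨hopen', hdet'⟩ := hdet ψ' hψ'
  have hpc := isPseudoCoeff_stG_of_ep L v hns νQv mQv 𝔇 hμG horb hreg hE hM1 detZ hopen' hdet' (hOpp ψ' hψ') hfGs h1 h0
  rw [← hPCT (𝔇.stG ψ') (𝔇.stG ψ) _ hpc, hμG]
  exact F0P3cStCharTSEPTracesPF.smoothTrace_stG_epSt L v w hw eA heA hns g₁ hg₁ K0 K1 I hK0 hK1 hI νQv fG hfG ι hιc hι detZ hdetZ μZ 𝔇.stG 𝔇.detG hdet hne hJH hStL2 hDet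
    hϖ ψ ψ' hψ hψ'

include heA hns hg₁ hK0 hK1 hI hfG hιc hι hdetZ hμG horb hreg hE hM1 hPCT hfGs h1 h0 hdet hne hJH hStL2 hDet in
open Classical in
set_option maxHeartbeats 1600000 in
set_option synthInstance.maxHeartbeats 400000 in
-- instance-path unification between `Gqs L v` and the literal carrier of ★ `cmPrincipalSeries`
/-- **TABLE ROW 2: `⟨χ_{St_G(ψ)}, χ_{ψ′∘det_G}⟩_e = −[ψ = ψ′]`** (★ PCT at the pseudo-coefficient `f_{det ψ′}` of ★ (G5) A `isPseudoCoeff_detG_of_ep`; §1 `F0P3cStCharTSEPTracesPF.smoothTrace_stG_epDet`).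
[cite: Rogawski1990, §12.6 Prop. 12.6.1 (b) p. 188; §12.5 p. 184] [cite: Kottwitz1988, §2 Theorem 2] -/
theorem innerG_char_stG_detG (hϖ : Valued.v ϖ = WithZero.exp (-1 : ℤ)) (ψ ψ' : ↥(Subgroup.center (Gqs L v)) →* ℂˣ) (hψ : Continuous ψ) (hψ' : Continuous ψ') :
    𝔇.innerG (𝔇.char (𝔇.stG ψ)) (𝔇.char (𝔇.detG ψ')) = -(if ψ = ψ' then 1 else 0) := by
  obtain ⟨hopen', hdet'⟩ := hdet ψ' hψ'
  have hpc := isPseudoCoeff_detG_of_ep L v hns νQv mQv 𝔇 hμG horb hreg hE hM1 detZ hopen' hdet' hfGs h1 h0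
  rw [← hPCT (𝔇.detG ψ') (𝔇.stG ψ) _ hpc, hμG]
  exact F0P3cStCharTSEPTracesPF.smoothTrace_stG_epDet L v w hw eA heA hns g₁ hg₁ K0 K1 I hK0 hK1 hI νQv fG hfG ι hιc hι detZ hdetZ μZ 𝔇.stG 𝔇.detG hdet hne hJH hStL2 hDet
    hϖ ψ ψ' hψ hψ'

include heA hns hg₁ hK0 hK1 hI hfG hι hdetZ hμG horb hreg hE hM1 hPCT hfGs h1 h0 hdet in
open Classical in
/-- **TABLE ROW 3: `⟨χ_{ψ∘det_G}, χ_{ψ′∘det_G}⟩_e = [ψ = ψ′]`** (★ PCT at `f_{det ψ′}`; §1 `F0P3cStCharTSEPTracesPF.smoothTrace_detG_epDet`).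
[cite: Rogawski1990, §12.6 Prop. 12.6.1 (b) p. 188; §12.5 p. 184] [cite: Kottwitz1988, §2 Theorem 2] -/
theorem innerG_char_detG_detG (hϖ : Valued.v ϖ = WithZero.exp (-1 : ℤ)) (ψ ψ' : ↥(Subgroup.center (Gqs L v)) →* ℂˣ) (hψ : Continuous ψ) (hψ' : Continuous ψ') :
    𝔇.innerG (𝔇.char (𝔇.detG ψ)) (𝔇.char (𝔇.detG ψ')) = if ψ = ψ' then 1 else 0 := by
  obtain ⟨hopen', hdet'⟩ := hdet ψ' hψ'
  have hpc := isPseudoCoeff_detG_of_ep L v hns νQv mQv 𝔇 hμG horb hreg hE hM1 detZ hopen' hdet' hfGs h1 h0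
  rw [← hPCT (𝔇.detG ψ') (𝔇.detG ψ) _ hpc, hμG]
  exact F0P3cStCharTSEPTracesPF.smoothTrace_detG_epDet L v w hw eA heA hns g₁ hg₁ K0 K1 I hK0 hK1 hI νQv fG hfG ι hι detZ hdetZ 𝔇.detG hdet hϖ ψ ψ' hψ hψ'

/-! ## §3 HEAD: the EP-family instance of Prop. 12.6.1 (b) at the datum — the `hEP` binder of ★ `prop1261bNs_of_cases` -/

include heA hns hg₁ hK0 hK1 hI hfG hιc hι hdetZ hμG horb hreg hE hM1 hPCT hfGs h1 h0 hdet hne hJH hStL2 hDet hOpp in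
set_option maxHeartbeats 1600000 in
set_option synthInstance.maxHeartbeats 400000 in
-- instance-path unification between `Gqs L v` and the literal carrier of ★ `cmPrincipalSeries`
/-- **RIDER 2b «EP-PAIRS» — THE EP-FAMILY INSTANCE OF PROP. 12.6.1 (b) AT A §12.5 DATUM ON `U(Φ₃)(L⁺_v)`.**  If `π, π′ ∈ {St_G(ψ), ψ∘det_G : ψ continuous}`,
`⟨χ_π, χ_{π′}⟩_e ≠ 0` and `π ≠ π′`, then `{π, π′} = {St_G(ψ), ψ∘det_G}` for one `ψ` (`𝔇.IsEllipticPair π π′`): ★ `isEllipticPairEP_of_table` on the three rows of §2 — the `hEP`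
binder of ★ `F0P3cStCharTSP1261bOfCases.prop1261bNs_of_cases 𝔇 hEP hRest`, TOKEN FOR TOKEN, in the letters of ★ (G3)-EXPLICIT, ★ ST-PIN, ★ (G5) A and ★ PCT-OUT.
[cite: Rogawski1990, §12.6 Prop. 12.6.1 (b) p. 188] [cite: Kottwitz1988, §2 Theorem 2] -/
theorem isEllipticPairEP_datum (hϖ : Valued.v ϖ = WithZero.exp (-1 : ℤ)) :
    ∀ π π' : IrrClass (Gqs L v),
      (∃ ψ : ↥(Subgroup.center (Gqs L v)) →* ℂˣ, Continuous ψ ∧ (π = 𝔇.stG ψ ∨ π = 𝔇.detG ψ)) →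
      (∃ ψ' : ↥(Subgroup.center (Gqs L v)) →* ℂˣ, Continuous ψ' ∧ (π' = 𝔇.stG ψ' ∨ π' = 𝔇.detG ψ')) →
      𝔇.innerG (𝔇.char π) (𝔇.char π') ≠ 0 → π ≠ π' → 𝔇.IsEllipticPair π π' := by
  classical
  refine isEllipticPairEP_of_table 𝔇 (fun ψ ψ' hψ hψ' hneq => ?_) (fun ψ ψ' hψ hψ' hne0 => ?_) (fun ψ ψ' hψ hψ' hneq => ?_)
  · rw [innerG_char_stG_stG L v w hw eA heA hns g₁ hg₁ K0 K1 I hK0 hK1 hI νQv fG hfG ι hιc hι detZ hdetZ μZ mQv 𝔇 hμG horb hreg hE hM1 hPCT hfGs h1 h0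
      hdet hne hJH hStL2 hDet hOpp hϖ ψ ψ' hψ hψ', if_neg]
    rintro rfl
    exact hneq rfl
  · by_contra h
    rw [innerG_char_stG_detG L v w hw eA heA hns g₁ hg₁ K0 K1 I hK0 hK1 hI νQv fG hfG ι hιc hι detZ hdetZ μZ mQv 𝔇 hμG horb hreg hE hM1 hPCT hfGs h1 h0
      hdet hne hJH hStL2 hDet hϖ ψ ψ' hψ hψ', if_neg h, neg_zero] at hne0
    exact hne0 rfl
  · rw [innerG_char_detG_detG L v w hw eA heA hns g₁ hg₁ K0 K1 I hK0 hK1 hI νQv fG hfG ι hι detZ hdetZ mQv 𝔇 hμG horb hreg hE hM1 hPCT hfGs h1 h0 hdet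
      hϖ ψ ψ' hψ hψ', if_neg]
    rintro rfl
    exact hneq rfl

end Datum

end Table

/-! ## §4 HEADS over ★ NOT-WILD p853198: `isEllipticPair_of_epFamily_of_not_wild` (+ `_of_PS2`) -/

set_option maxHeartbeats 1600000 in
set_option synthInstance.maxHeartbeats 400000 in
-- instance-path unification between `Gqs L v` and the literal carrier of ★ `cmPrincipalSeries`; statement-level `whnf` on the CM carriers
/-- **RIDER 2b⁺ «EP-PAIRS NOT-WILD» — THE EP-FAMILY INSTANCE OF PROP. 12.6.1 (b) AT A §12.5 DATUM ON `U(Φ₃)(L⁺_v)`, `v` NON-SPLIT AND NOT WILDLY RAMIFIED IN `L`**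
(`v` unramified in `L` OR `|2|_v = 1`).  If `π, π′ ∈ {St_G(ψ), ψ∘det_G : ψ continuous}`, `⟨χ_π, χ_{π′}⟩_e ≠ 0` and `π ≠ π′`, then `𝔇.IsEllipticPair π π′`.  Same binders as ★ H
`F0P3cStCharTSEPPairsDatum.isEllipticPair_of_epFamily` with `hunr` WIDENED to `hv` (= RIDER 2a′'s place token verbatim); the place `w`, the one-place model and — ONCE — the
uniformiser with Kottwitz's `f_EP` and its eight clauses come from ★ NOT-WILD `exists_uniformizer_epFunction_G_explicit_of_not_wild` p853198; then ★ PCT-OUT and §3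
`isEllipticPairEP_datum` over the place-free layer P1–P3. [cite: Rogawski1990, §12.6 Prop. 12.6.1 (b) p. 188; §12.5 p. 184] [cite: Kottwitz1988, §2 Theorem 2] -/
theorem isEllipticPair_of_epFamily_of_not_wild (hns : ∀ w : PlacesOver L v, IsCMField.complexConj L • w.1 = w.1)
    (hv : Algebra.IsUnramifiedIn (𝓞 L) v.asIdeal ∨ Valued.v (2 : v.adicCompletion ↥(maximalRealSubfield L)) = 1)
    [MeasurableSpace (Gqs L v)] [BorelSpace (Gqs L v)]
    [∀ γ : Gqs L v, MeasurableSpace (Gqs L v ⧸ Subgroup.centralizer ({γ} : Set (Gqs L v)))]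
    [∀ γ : Gqs L v, BorelSpace (Gqs L v ⧸ Subgroup.centralizer ({γ} : Set (Gqs L v)))]
    [MeasurableSpace (Gqs L v ⧸ Subgroup.center (Gqs L v))]
    {H : Type} [Group H] [TopologicalSpace H] [IsTopologicalGroup H] [MeasurableSpace H]
    (νQv : Measure (Gqs L v)) [νQv.IsHaarMeasure] [νQv.IsMulRightInvariant]
    {mQv : OrbitalMeasureFamily (Gqs L v)}
    (hcanQ : mQv.IsCanonical (fun γ => IsRegularElt (γ.val : GL (Fin 3) (UnitaryGroup.LocalRing L v))) νQv)
    (𝔇 : EllipticData (Gqs L v) H)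
    (hμG : 𝔇.μG = νQv) (horb : 𝔇.orb = mQv)
    (hreg : ∀ γ : Gqs L v, γ ∈ 𝔇.regG ↔ IsRegularElt (γ.val : GL (Fin 3) (UnitaryGroup.LocalRing L v)))
    (hE : ∀ γ : Gqs L v, γ ∈ 𝔇.ellG ↔ IsRegularElt (γ.val : GL (Fin 3) (UnitaryGroup.LocalRing L v)) ∧ γ ∉ hyperbolicSet L v)
    (hM1 : ∀ π : IrrClass (Gqs L v), Measurable (𝔇.char π) ∧ LocallyIntegrable (𝔇.char π) 𝔇.μG ∧
      (∀ x ∈ 𝔇.regG, ∀ᶠ y in 𝓝 x, 𝔇.char π y = 𝔇.char π x) ∧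
      ∀ φ : Gqs L v → ℂ, IsLocSmooth φ → π.smoothTrace 𝔇.μG φ = ∫ x, φ x * 𝔇.char π x ∂𝔇.μG)
    (hWIF : 𝔇.WeylIntegrationFormula) (hC1 : 𝔇.EllCartanSubset) (hC2 : 𝔇.EllCartanAE) (hC3 : 𝔇.NonEllCartanAE) (hL2 : 𝔇.L2CharOnTorusAll)
    (ι : ↥(normOneUnits (conjLocal L (IsCMField.complexConj L) v)) →* ↥(Subgroup.center (Gqs L v))) (hιc : Continuous ι)
    (hι : ∀ z : ↥(normOneUnits (conjLocal L (IsCMField.complexConj L) v)),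
      ((ι z).val.val.val : Matrix (Fin 3) (Fin 3) (LocalRing L v)) = (((z : (LocalRing L v)ˣ) : LocalRing L v)) • (1 : Matrix (Fin 3) (Fin 3) (LocalRing L v)))
    (detZ : Gqs L v →* ↥(Subgroup.center (Gqs L v)))
    (hdetZ : ∀ g : Gqs L v, ((detZ g).val.val.val : Matrix (Fin 3) (Fin 3) (LocalRing L v)) =
        (g.val.val : Matrix (Fin 3) (Fin 3) (LocalRing L v)).det • (1 : Matrix (Fin 3) (Fin 3) (LocalRing L v)))
    (μZ : Measure (Gqs L v ⧸ Subgroup.center (Gqs L v)))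
    (hdet : ∀ ψ : ↥(Subgroup.center (Gqs L v)) →* ℂˣ, Continuous ψ →
      ∃ hopen : IsOpen (((ψ.comp detZ).ker : Subgroup (Gqs L v)) : Set (Gqs L v)), 𝔇.detG ψ = IrrClass.mk (SmoothIrrep.ofChar (ψ.comp detZ) hopen))
    (hne : ∀ ψ : ↥(Subgroup.center (Gqs L v)) →* ℂˣ, Continuous ψ → 𝔇.stG ψ ≠ 𝔇.detG ψ)
    (hJH : ∀ ψ : ↥(Subgroup.center (Gqs L v)) →* ℂˣ, Continuous ψ → ∀ c : IrrClass (Gqs L v),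
      c.IsConstituentOf (cmPrincipalSeries L 3 v
        (cmTorusCharPair L v (halfModulusChar (LocalRing L v) * halfModulusChar (LocalRing L v))⁻¹ (ψ.comp ι))) ↔ (c = 𝔇.stG ψ ∨ c = 𝔇.detG ψ))
    (hStL2 : ∀ ψ : ↥(Subgroup.center (Gqs L v)) →* ℂˣ, Continuous ψ → (𝔇.stG ψ).IsSquareIntegrable μZ)
    (hDet : ∀ ψ : ↥(Subgroup.center (Gqs L v)) →* ℂˣ, Continuous ψ → ¬ (𝔇.detG ψ).IsSquareIntegrable μZ)
    (hOpp : ∀ ψ : ↥(Subgroup.center (Gqs L v)) →* ℂˣ, Continuous ψ → ∀ γ ∈ 𝔇.ellG, 𝔇.char (𝔇.stG ψ) γ = -𝔇.char (𝔇.detG ψ) γ) :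
    ∀ π π' : IrrClass (Gqs L v),
      (∃ ψ : ↥(Subgroup.center (Gqs L v)) →* ℂˣ, Continuous ψ ∧ (π = 𝔇.stG ψ ∨ π = 𝔇.detG ψ)) →
      (∃ ψ' : ↥(Subgroup.center (Gqs L v)) →* ℂˣ, Continuous ψ' ∧ (π' = 𝔇.stG ψ' ∨ π' = 𝔇.detG ψ')) →
      𝔇.innerG (𝔇.char π) (𝔇.char π') ≠ 0 → π ≠ π' → 𝔇.IsEllipticPair π π' := by
  classical
  obtain ⟨w⟩ : Nonempty (PlacesOver L v) := inferInstance
  have hw : IsCMField.complexConj L • w.1 = w.1 := hns w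
  haveI : Algebra.IsQuadraticExtension ↥(maximalRealSubfield L) L := IsCMField.isQuadraticExtension L
  -- the one-place model on `Φ₃ = antidiag(1,1,1)` (★ (G3) §1 verbatim)
  have hJw : placeForm (qsForm L) w.1 = (StdForm.antidiagonal 3).over (w.1.adicCompletion L) := by
    rw [placeForm, qsForm, antidiagOne_eq_over, StdForm.over_map]
  obtain ⟨eA, heA⟩ : ∃ eA : Gqs L v ≃ₜ* ↥(unitaryGroupOfForm (galAdicCompletionMap (L := L) (IsCMField.complexConj L) hw) ((StdForm.antidiagonal 3).over (w.1.adicCompletion L))),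
      ∀ g : Gqs L v, ((eA g : ↥(unitaryGroupOfForm (galAdicCompletionMap (L := L) (IsCMField.complexConj L) hw) ((StdForm.antidiagonal 3).over (w.1.adicCompletion L)))) :
          GL (Fin 3) (w.1.adicCompletion L)) =
        ((localNonsplitEquiv (IsCMField.complexConj L) (qsForm L) (IsCMField.complexConj_ne_one L) w hw g :
          ↥(unitaryGroupOfForm (galAdicCompletionMap (L := L) (IsCMField.complexConj L) hw) (placeForm (qsForm L) w.1))) : GL (Fin 3) (w.1.adicCompletion L)) := by
    rw [← hJw]
    exact ⟨localNonsplitEquiv (IsCMField.complexConj L) (qsForm L) (IsCMField.complexConj_ne_one L) w hw, fun g => rfl⟩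
  -- ★ NOT-WILD junction p853198: a uniformiser `ϖ` and the eight clauses of the displayed `f_EP`, ONCE (LEAD T15-25 (b)(c), right-hand reading)
  obtain ⟨ϖ, hϖ, hEP⟩ := F0P3cStCharTSEPGlueGExplicitNotWild.exists_uniformizer_epFunction_G_explicit_of_not_wild L v hns hv w hw eA heA νQv hcanQ
  have hϖ0 : ϖ ≠ 0 := fun h0 => by rw [h0, map_zero] at hϖ; exact WithZero.zero_ne_coe hϖ
  set g₁ : GL (Fin 3) (w.1.adicCompletion L) := glDiagonal 3 (w.1.adicCompletion L) ![1, 1, Units.mk0 ϖ hϖ0] with hg₁def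
  have hg₁ : (g₁ : Matrix (Fin 3) (Fin 3) (w.1.adicCompletion L)) = Matrix.diagonal ![(1 : w.1.adicCompletion L), 1, ϖ] := by
    rw [hg₁def, coe_glDiagonal]
    congr 1
    funext i
    fin_cases i <;> rfl
  obtain ⟨hfGs, -, -, -, -, -, h1, h0⟩ := hEP g₁ hg₁ _ _ _ rfl rfl rfl _ rfl
  -- ★ PCT-OUT
  have hPCT := F0P3cStCharTSPctOut.pseudoCoeffTrace_Gqs L v hns νQv 𝔇 hμG hreg hM1 hWIF hC1 hC2 hC3 hL2
  exact isEllipticPairEP_datum L v w hw eA heA hns g₁ hg₁ _ _ _ rfl rfl rfl νQv _ rfl ι hιc hι detZ hdetZ μZ mQv 𝔇 hμG horb hreg hE hM1 hPCT hfGs h1 h0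
    hdet hne hJH hStL2 hDet hOpp hϖ

set_option maxHeartbeats 1600000 in
set_option synthInstance.maxHeartbeats 400000 in
-- instance-path unification between `Gqs L v` and the literal carrier of ★ `cmPrincipalSeries`; statement-level `whnf` on the CM carriers
/-- **§4 with `hOpp` discharged** by ★ (G5) C `charOpposite_stG_detG_of_PS2` (★ OPP-23 at the kind-2 pair) from ELL-OPEN `hopen'`, the pair sockets (PS2) `hPS2` ∕ (NONL2-PAR) `hNP`
with the parameter map `par`, and the pin's `h𝔇` clauses `hStIsL2`, `hDetNotL2` — letters of ★ H `isEllipticPair_of_epFamily_of_PS2` with `hunr ↦ hv`.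
[cite: Rogawski1990, §12.6 Prop. 12.6.1 (b)(c) p. 188; §12.7 L. 12.7.2 (proof) p. 192] [cite: Kottwitz1988, §2 Theorem 2] -/
theorem isEllipticPair_of_epFamily_of_not_wild_of_PS2 (hns : ∀ w : PlacesOver L v, IsCMField.complexConj L • w.1 = w.1)
    (hv : Algebra.IsUnramifiedIn (𝓞 L) v.asIdeal ∨ Valued.v (2 : v.adicCompletion ↥(maximalRealSubfield L)) = 1)
    [MeasurableSpace (Gqs L v)] [BorelSpace (Gqs L v)]
    [∀ γ : Gqs L v, MeasurableSpace (Gqs L v ⧸ Subgroup.centralizer ({γ} : Set (Gqs L v)))]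
    [∀ γ : Gqs L v, BorelSpace (Gqs L v ⧸ Subgroup.centralizer ({γ} : Set (Gqs L v)))]
    [MeasurableSpace (Gqs L v ⧸ Subgroup.center (Gqs L v))]
    {H : Type} [Group H] [TopologicalSpace H] [IsTopologicalGroup H] [MeasurableSpace H]
    (νQv : Measure (Gqs L v)) [νQv.IsHaarMeasure] [νQv.IsMulRightInvariant]
    {mQv : OrbitalMeasureFamily (Gqs L v)}
    (hcanQ : mQv.IsCanonical (fun γ => IsRegularElt (γ.val : GL (Fin 3) (UnitaryGroup.LocalRing L v))) νQv)
    (𝔇 : EllipticData (Gqs L v) H)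
    (hμG : 𝔇.μG = νQv) (horb : 𝔇.orb = mQv)
    (hreg : ∀ γ : Gqs L v, γ ∈ 𝔇.regG ↔ IsRegularElt (γ.val : GL (Fin 3) (UnitaryGroup.LocalRing L v)))
    (hE : ∀ γ : Gqs L v, γ ∈ 𝔇.ellG ↔ IsRegularElt (γ.val : GL (Fin 3) (UnitaryGroup.LocalRing L v)) ∧ γ ∉ hyperbolicSet L v)
    (hopen' : IsOpen {g : Gqs L v | IsRegularElt (g.val : GL (Fin 3) (UnitaryGroup.LocalRing L v)) ∧ g ∉ hyperbolicSet L v})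
    (hM1 : ∀ π : IrrClass (Gqs L v), Measurable (𝔇.char π) ∧ LocallyIntegrable (𝔇.char π) 𝔇.μG ∧
      (∀ x ∈ 𝔇.regG, ∀ᶠ y in 𝓝 x, 𝔇.char π y = 𝔇.char π x) ∧
      ∀ φ : Gqs L v → ℂ, IsLocSmooth φ → π.smoothTrace 𝔇.μG φ = ∫ x, φ x * 𝔇.char π x ∂𝔇.μG)
    (hWIF : 𝔇.WeylIntegrationFormula) (hC1 : 𝔇.EllCartanSubset) (hC2 : 𝔇.EllCartanAE) (hC3 : 𝔇.NonEllCartanAE) (hL2 : 𝔇.L2CharOnTorusAll)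
    (par : IrrClass (Gqs L v) → (((UnitaryGroup.LocalRing L v)ˣ →* ℂˣ) × (↥(normOneUnits (conjLocal L (IsCMField.complexConj L) v)) →* ℂˣ)))
    (hPS2 : ∀ π σ : IrrClass (Gqs L v), ¬ 𝔇.IsL2 π → 𝔇.IsL2 σ → 𝔇.IsEllipticPair π σ → ∀ f : Gqs L v → ℂ, IsLocSmooth f →
        π.smoothTrace νQv f + σ.smoothTrace νQv f =
          Representation.smoothTrace (G := Gqs L v) (UnitaryGroup.cmPrincipalSeries L 3 v (UnitaryGroup.cmTorusCharPair L v (par π).1 (par π).2)) νQv f)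
    (hNP : ∀ π : IrrClass (Gqs L v), ¬ 𝔇.IsL2 π →
        π.IsConstituentOf (UnitaryGroup.cmPrincipalSeries L 3 v (UnitaryGroup.cmTorusCharPair L v (par π).1 (par π).2)) ∧
          Continuous (par π).1 ∧ Continuous (par π).2)
    (ι : ↥(normOneUnits (conjLocal L (IsCMField.complexConj L) v)) →* ↥(Subgroup.center (Gqs L v))) (hιc : Continuous ι)
    (hι : ∀ z : ↥(normOneUnits (conjLocal L (IsCMField.complexConj L) v)),
      ((ι z).val.val.val : Matrix (Fin 3) (Fin 3) (LocalRing L v)) = (((z : (LocalRing L v)ˣ) : LocalRing L v)) • (1 : Matrix (Fin 3) (Fin 3) (LocalRing L v)))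
    (detZ : Gqs L v →* ↥(Subgroup.center (Gqs L v)))
    (hdetZ : ∀ g : Gqs L v, ((detZ g).val.val.val : Matrix (Fin 3) (Fin 3) (LocalRing L v)) =
        (g.val.val : Matrix (Fin 3) (Fin 3) (LocalRing L v)).det • (1 : Matrix (Fin 3) (Fin 3) (LocalRing L v)))
    (μZ : Measure (Gqs L v ⧸ Subgroup.center (Gqs L v)))
    (hdet : ∀ ψ : ↥(Subgroup.center (Gqs L v)) →* ℂˣ, Continuous ψ →
      ∃ hopen : IsOpen (((ψ.comp detZ).ker : Subgroup (Gqs L v)) : Set (Gqs L v)), 𝔇.detG ψ = IrrClass.mk (SmoothIrrep.ofChar (ψ.comp detZ) hopen))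
    (hne : ∀ ψ : ↥(Subgroup.center (Gqs L v)) →* ℂˣ, Continuous ψ → 𝔇.stG ψ ≠ 𝔇.detG ψ)
    (hJH : ∀ ψ : ↥(Subgroup.center (Gqs L v)) →* ℂˣ, Continuous ψ → ∀ c : IrrClass (Gqs L v),
      c.IsConstituentOf (cmPrincipalSeries L 3 v
        (cmTorusCharPair L v (halfModulusChar (LocalRing L v) * halfModulusChar (LocalRing L v))⁻¹ (ψ.comp ι))) ↔ (c = 𝔇.stG ψ ∨ c = 𝔇.detG ψ))
    (hStL2 : ∀ ψ : ↥(Subgroup.center (Gqs L v)) →* ℂˣ, Continuous ψ → (𝔇.stG ψ).IsSquareIntegrable μZ)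
    (hDet : ∀ ψ : ↥(Subgroup.center (Gqs L v)) →* ℂˣ, Continuous ψ → ¬ (𝔇.detG ψ).IsSquareIntegrable μZ)
    (hStIsL2 : ∀ ψ : ↥(Subgroup.center (Gqs L v)) →* ℂˣ, Continuous ψ → 𝔇.IsL2 (𝔇.stG ψ)) (hDetNotL2 : 𝔇.DetNotL2) :
    ∀ π π' : IrrClass (Gqs L v),
      (∃ ψ : ↥(Subgroup.center (Gqs L v)) →* ℂˣ, Continuous ψ ∧ (π = 𝔇.stG ψ ∨ π = 𝔇.detG ψ)) →
      (∃ ψ' : ↥(Subgroup.center (Gqs L v)) →* ℂˣ, Continuous ψ' ∧ (π' = 𝔇.stG ψ' ∨ π' = 𝔇.detG ψ')) →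
      𝔇.innerG (𝔇.char π) (𝔇.char π') ≠ 0 → π ≠ π' → 𝔇.IsEllipticPair π π' :=
  isEllipticPair_of_epFamily_of_not_wild L v hns hv νQv hcanQ 𝔇 hμG horb hreg hE hM1 hWIF hC1 hC2 hC3 hL2 ι hιc hι detZ hdetZ μZ hdet hne hJH hStL2 hDet
    (fun ψ hψ => charOpposite_stG_detG_of_PS2 L v hns νQv mQv hcanQ 𝔇 hμG hreg (fun γ hγ => (hE γ).1 hγ) hopen' hM1 par hPS2 hNP hψ
      (hDetNotL2 ψ hψ) (hStIsL2 ψ hψ))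

end Summit.HodgeConjecture.HodgeConjecture.Cruxes.H413.F0P3cStCharTSEPPairsNotWild

end
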